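import Summits.HubbardSuperconductivity.HubbardSuperconductivity.Theorems.KacWindowPenaltyWindowGapStubDressingInvisible
import Summits.HubbardSuperconductivity.HubbardSuperconductivity.Theorems.KacWindowPenaltyWindowGapStubWindowDominates
import Summits.HubbardSuperconductivity.HubbardSuperconductivity.Theorems.KacWindowPenaltyWindowGapStubSourceRemoval
import Summits.HubbardSuperconductivity.HubbardSuperconductivity.Theorems.KacWindowPenaltyWindowGapStubSectorLipschitz
import Summits.HubbardSuperconductivity.HubbardSuperconductivity.Theorems.KacWindowPenaltyWindowGapStubGcBlockFloor

/-!
# Crux `WindowGap` (stmt-HubbardSuperconductivity-1088) — the DRESSED REDUCTION of line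
# `sector-invisible-dressing` (idea card `Cruxes/WindowGap/Ideas/sector-invisible-dressing.md`)

The sorry-free composition of the line, landed as a support so that the registered skeleton
(`Cruxes/WindowGap/Lines/sector-invisible-dressing.lean`) is `windowGap_of_windowOrder` applied to its
one physics stub. With `H_L = hubbardTorus 2 L 1 U`, `K_L = szSector N_L 0`, `W_ε` the crux's Kac
window, `Δ_d = pairField dWaveFormFactor L`, `N̂ = totalNumber`:

* `windowGap_dressedBridge` — abstract (any matrices): if `S` has zero quadratic form on `K ≤ K'`, `W`
  dominates `(Re⟨A⟩)²/c` on unit vectors of `K'`, and every unit minimiser of `X + λW + S` on `K'`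
  has `Re⟨A⟩ ≥ m ≥ 0`, then `minE(X + S | K') + λm²/c ≤ minE(X + λW | K)`.
* `windowGap_chargingFloor` — `minE(H_L | szSector (2n) 0) − B₀²/(4k) ≤ minE(H_L − μ(N̂ − 2n) + k(N̂ − 2n)² | ⊤)`
  for `2n ≤ L² ≤ 8n`, `k > 0`, `B₀ = 144(2+|U|) + |μ|` (landed stubs `stub_sectorLipschitz`,
  `stub_gcBlockFloor` + SU(2) `groundEnergyAt_eq_minEnergyOn_szSector`): the chemically shifted,
  Kac-charged grand-canonical torus lies at most `B₀²/(4k)` below the sector energy.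
* `windowGapAt_of_parts` — one side `L`: dressing `S = −μ(N̂−2n) + k(N̂−2n)² − h(Δ_d+Δ_dᴴ)` with
  `h = λm⋆²/64`, `k = B²/(λm⋆²L²)`, `B ≥ B₀`, an order floor `Re⟨φ,Δ_dφ⟩ ≥ m⋆L²` for the unit
  minimisers of `H_L + λW + S` on `⊤`, and `Cε ≤ m⋆²/4` give `λ(Cε + m⋆²/4)L² ≤ minE(H_L + λW | K) −
  minE(H_L | K)` (bridge with `c = L²`, landed stubs `stub_dressingInvisible`, `stub_sourceRemoval`,
  `windowGap_dressedBookkeeping`).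
* `windowGapAt_of_windowOrderAt` — at ANY real `U` and `δ ∈ (0,1/2)`: robust quasi-average `d`-wave
  order of the charged, weakly window-repelled, weakly sourced grand-canonical Hubbard torus at
  `(U, δ, μ)` implies the crux BODY at `(U, δ)` (`ε := min ε₁ (min ε₀ (m⋆²/(4C+4)))`, `a := m⋆²/4`,
  threshold `max L₀ 4`, `stub_windowDominates`); `windowGap_of_windowOrder` — **the reduction**: the
  line's stub `stub_windowOrder` (the same at some `U > 0`, verbatim as hypothesis) implies `WindowGap`.

Sources: P. W. Anderson, Phys. Rev. 112 (1958) 1900 (charging / number–phase dress of the BCS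
state); N. N. Bogoliubov, Physica 26 (1960) S1 (quasi-averages); H. Tasaki, *Physics and
Mathematics of Quantum Many-Body Systems* (2020) §2.1 (variational principle). Folklore
finite-dimensional statements; no named facts, no definitions.
-/

set_option linter.dupNamespace false

noncomputable section

namespace Summit.HubbardSuperconductivity.HubbardSuperconductivity.Theorems

open Matrix Literature.MathematicalPhysics.QuantumLattice
open Summit.HubbardSuperconductivity.HubbardSuperconductivity.Theses.KacWindowPenalty (WindowGap)

section Abstract

variable {n : Type*} [Fintype n]

/-- **Sector-invisible dressing + source-pinned Cauchy–Schwarz (ideator 1, PROVED).**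
`X` the Hamiltonian, `W` the penalty, `S` a dressing with zero quadratic form on the sector
`K ≤ K'`, `A` the order field with `(Re ⟨φ, Aφ⟩)²/c ≤ Re ⟨φ, Wφ⟩` on unit vectors of `K'`. If every
unit minimiser `φ ∈ K'` of `X + λW + S` has `m ≤ Re ⟨φ, A φ⟩` (`0 ≤ m`, `0 ≤ λ`), then
`minEnergyOn (X + S) K' + λ m² / c ≤ minEnergyOn (X + λ W) K`. [folklore] -/
theorem windowGap_dressedBridge (X W S A : Matrix n n ℂ) (K K' : Submodule ℂ (n → ℂ)) (hKK' : K ≤ K')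
    (hK : ∃ ψ ∈ K, star ψ ⬝ᵥ ψ = 1)
    (hS : ∀ ψ ∈ K, star ψ ⬝ᵥ ψ = 1 → (star ψ ⬝ᵥ S *ᵥ ψ).re = 0)
    {c lam m : ℝ} (hc : 0 < c) (hlam : 0 ≤ lam) (hm : 0 ≤ m)
    (hWA : ∀ φ ∈ K', star φ ⬝ᵥ φ = 1 →
      (star φ ⬝ᵥ A *ᵥ φ).re ^ 2 / c ≤ (star φ ⬝ᵥ W *ᵥ φ).re)
    (hGS : ∀ φ ∈ K', star φ ⬝ᵥ φ = 1 →
      (star φ ⬝ᵥ (X + (lam : ℂ) • W + S) *ᵥ φ).re = (X + (lam : ℂ) • W + S).minEnergyOn K' →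
        m ≤ (star φ ⬝ᵥ A *ᵥ φ).re) :
    (X + S).minEnergyOn K' + lam * m ^ 2 / c ≤ (X + (lam : ℂ) • W).minEnergyOn K := by
  obtain ⟨ψ₀, hψ₀K, hψ₀⟩ := hK
  obtain ⟨φ, hφK', hφ, hmin⟩ :=
    exists_unit_re_rayleigh_eq_minEnergyOn (X + (lam : ℂ) • W + S) K' ⟨ψ₀, hKK' hψ₀K, hψ₀⟩
  have step1 : (X + (lam : ℂ) • W + S).minEnergyOn K' ≤ (X + (lam : ℂ) • W).minEnergyOn K := by
    refine le_csInf ⟨_, ψ₀, hψ₀K, hψ₀, rfl⟩ ?_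
    rintro E ⟨ψ, hψK, hψ, rfl⟩
    have hv := minEnergyOn_le_re_rayleigh (X + (lam : ℂ) • W + S) K' (hKK' hψK) hψ
    rw [add_mulVec (X + (lam : ℂ) • W) S, dotProduct_add, Complex.add_re, hS ψ hψK hψ,
      add_zero] at hv
    exact hv
  have hXS := minEnergyOn_le_re_rayleigh (X + S) K' hφK' hφ
  have hW := hWA φ hφK' hφ
  have hA := hGS φ hφK' hφ hmin
  have e1 : (star φ ⬝ᵥ (X + (lam : ℂ) • W + S) *ᵥ φ).re =
      (star φ ⬝ᵥ X *ᵥ φ).re + lam * (star φ ⬝ᵥ W *ᵥ φ).re + (star φ ⬝ᵥ S *ᵥ φ).re := by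
    rw [add_mulVec, add_mulVec, dotProduct_add, dotProduct_add, Complex.add_re, Complex.add_re,
      smul_mulVec, dotProduct_smul, smul_eq_mul, Complex.re_ofReal_mul]
  have e2 : (star φ ⬝ᵥ (X + S) *ᵥ φ).re = (star φ ⬝ᵥ X *ᵥ φ).re + (star φ ⬝ᵥ S *ᵥ φ).re := by
    rw [add_mulVec, dotProduct_add, Complex.add_re]
  have hm2 : m ^ 2 ≤ (star φ ⬝ᵥ A *ᵥ φ).re ^ 2 := pow_le_pow_left₀ hm hA 2
  have hm3 : m ^ 2 / c ≤ (star φ ⬝ᵥ W *ᵥ φ).re :=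
    (div_le_div_of_nonneg_right hm2 hc.le).trans hW
  have hm4 : lam * (m ^ 2 / c) ≤ lam * (star φ ⬝ᵥ W *ᵥ φ).re :=
    mul_le_mul_of_nonneg_left hm3 hlam
  rw [mul_div_assoc]
  linarith [step1, hXS, e1, e2, hm4, hmin]

end Abstract

/-- **Bookkeeping of the constants (PROVED).** Penalty `λ`, order floor `m`, source `h = λm²/64`,
charging `k = B²/(λm²L²)` with `B ≥ B₀ > 0`: the three-term floor
`gap ≥ λ m² L² − 8√2 h L² − B₀²/(4k)` gives `λ (Cε + m²/4) L² ≤ gap` once `Cε ≤ m²/4`. [folklore] -/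
theorem windowGap_dressedBookkeeping (lam m Lsq C ε gap B B₀ : ℝ) (hlam : 0 < lam) (hm : 0 < m) (hL : 0 < Lsq)
    (hB₀ : 0 < B₀) (hB : B₀ ≤ B) (hCε : C * ε ≤ m ^ 2 / 4)
    (hgap : lam * m ^ 2 * Lsq - 8 * Real.sqrt 2 * (lam * m ^ 2 / 64) * Lsq
        - B₀ ^ 2 / (4 * (B ^ 2 / (lam * m ^ 2 * Lsq))) ≤ gap) :
    lam * (C * ε + m ^ 2 / 4) * Lsq ≤ gap := by
  have hs : Real.sqrt 2 ^ 2 = 2 := Real.sq_sqrt (by norm_num)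
  have hn : 0 ≤ Real.sqrt 2 := Real.sqrt_nonneg 2
  have hs2 : Real.sqrt 2 ≤ 2 := by nlinarith
  have hBpos : 0 < B := lt_of_lt_of_le hB₀ hB
  have hκ : B₀ ^ 2 / (4 * (B ^ 2 / (lam * m ^ 2 * Lsq))) = (B₀ ^ 2 / B ^ 2) * (lam * m ^ 2 * Lsq / 4) := by
    field_simp
  have hratio : B₀ ^ 2 / B ^ 2 ≤ 1 := by
    rw [div_le_one (by positivity)]
    exact pow_le_pow_left₀ hB₀.le hB 2
  have hmL : 0 ≤ lam * m ^ 2 * Lsq := by positivity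
  have hκ' : B₀ ^ 2 / (4 * (B ^ 2 / (lam * m ^ 2 * Lsq))) ≤ lam * m ^ 2 * Lsq / 4 := by
    rw [hκ]
    calc (B₀ ^ 2 / B ^ 2) * (lam * m ^ 2 * Lsq / 4) ≤ 1 * (lam * m ^ 2 * Lsq / 4) :=
          mul_le_mul_of_nonneg_right hratio (by positivity)
      _ = lam * m ^ 2 * Lsq / 4 := one_mul _
  have h1 : lam * (C * ε + m ^ 2 / 4) * Lsq ≤ lam * (m ^ 2 / 2) * Lsq := by
    have : C * ε + m ^ 2 / 4 ≤ m ^ 2 / 2 := by linarith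
    have := mul_le_mul_of_nonneg_left this hlam.le
    exact mul_le_mul_of_nonneg_right this hL.le
  nlinarith

/-! ### Derived: the charging floor (from `stub_sectorLipschitz`, `stub_gcBlockFloor`, SU(2)) -/

/-- **Charging floor.** For `2n ≤ L² ≤ 8n`, `0 < k` and any `μ`, the chemically shifted,
Kac-charged grand-canonical torus lies at most `B₀²/(4k)` below the `(2n, S^z = 0)` sector energy,
`B₀ = 144(2+|U|) + |μ|`: on the `N`-block it is `≥ E(2n) − B₀|N − 2n| + k(N − 2n)² ≥ E(2n) − B₀²/(4k)`
and `E(2n) = minE(H | szSector (2n) 0)` by `SU(2)` (`groundEnergyAt_eq_minEnergyOn_szSector`).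
[folklore] -/
theorem windowGap_chargingFloor (L : ℕ) [NeZero L] (U μ : ℝ) {k : ℝ} (hk : 0 < k) {n : ℕ}
    (hn : 2 * n ≤ L ^ 2) (hn' : L ^ 2 ≤ 8 * n) :
    (hubbardTorus 2 L 1 U).minEnergyOn (szSector (2 * n) 0) - (144 * (2 + |U|) + |μ|) ^ 2 / (4 * k) ≤
      (hubbardTorus 2 L 1 U +
        (-((μ : ℂ) • ((totalNumber : Matrix (Finset (Orb (FermionTorus 2 L)))
            (Finset (Orb (FermionTorus 2 L))) ℂ) - ((2 * n : ℕ) : ℂ) • 1)) +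
          (k : ℂ) • (((totalNumber : Matrix (Finset (Orb (FermionTorus 2 L)))
            (Finset (Orb (FermionTorus 2 L))) ℂ) - ((2 * n : ℕ) : ℂ) • 1) *
            ((totalNumber : Matrix (Finset (Orb (FermionTorus 2 L)))
            (Finset (Orb (FermionTorus 2 L))) ℂ) - ((2 * n : ℕ) : ℂ) • 1)))).minEnergyOn ⊤ := by
  have hcard : n ≤ Fintype.card (FermionTorus 2 L) := by
    rw [card_fermionTorus]; omega
  have hSU2 : (hubbardTorus 2 L 1 U).minEnergyOn (szSector (2 * n) 0) =
      groundEnergyAt (fermionTorusGraph 2 L) 1 U (2 * n) :=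
    (groundEnergyAt_eq_minEnergyOn_szSector (fermionTorusGraph 2 L) 1 U hcard).symm
  rw [hSU2]
  refine stub_gcBlockFloor L U μ k (2 * n) _ fun N hN => ?_
  have hLip := stub_sectorLipschitz L U hn hn' hN
  set t : ℝ := (N : ℝ) - ((2 * n : ℕ) : ℝ) with ht
  have ht' : |(N : ℝ) - 2 * n| = |t| := by rw [ht]; push_cast; ring_nf
  rw [ht'] at hLip
  have hB₀ : 0 ≤ 144 * (2 + |U|) + |μ| := by positivity
  have hμt : -(μ * t) ≥ -(|μ| * |t|) := by
    have := le_abs_self (μ * t)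
    rw [abs_mul] at this
    linarith
  -- `−B₀|t| + k t² ≥ −B₀²/(4k)`
  have hquad : -((144 * (2 + |U|) + |μ|) * |t|) + k * t ^ 2 ≥ -((144 * (2 + |U|) + |μ|) ^ 2 / (4 * k)) := by
    have hsq : 0 ≤ k * (|t| - (144 * (2 + |U|) + |μ|) / (2 * k)) ^ 2 := by positivity
    have habs : |t| ^ 2 = t ^ 2 := sq_abs t
    have hk' : k ≠ 0 := hk.ne'
    have hexp : k * (|t| - (144 * (2 + |U|) + |μ|) / (2 * k)) ^ 2 =
        k * t ^ 2 - (144 * (2 + |U|) + |μ|) * |t| + (144 * (2 + |U|) + |μ|) ^ 2 / (4 * k) := by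
      field_simp
      rw [← habs]
      ring
    linarith [hsq, hexp]
  nlinarith [hLip, hμt, hquad]

/-! ### The composition -/

/-- **One side `L` of the line's composition.** Given, at one even side `L` with sector
`K = szSector (2n) 0` (nonempty), penalty `λ > 0`, order floor `m⋆ > 0`, source `h = λm⋆²/64`,
charging `k = B²/(λm⋆²L²)`, `B ≥ B₀ = 144(2+|U|)+|μ| `, `2n ≤ L² ≤ 8n`, `Cε ≤ m⋆²/4`:
the dressing `S` invisible on `K`, the window `W` dominating `(Re⟨Δ_d⟩)²/L²`, the source-removal
bound for `Y = H + (−μ(N̂−2n) + k(N̂−2n)²)`, and the order floor for the minimisers of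
`H + λW + S` on `⊤` — then `λ(Cε + m⋆²/4)L² ≤ minE(H + λW | K) − minE(H | K)`. [folklore] -/
theorem windowGapAt_of_parts (L : ℕ) [NeZero L] (U μ : ℝ) {n : ℕ}
    (hn : 2 * n ≤ L ^ 2) (hn' : L ^ 2 ≤ 8 * n)
    (W S : Matrix (Finset (Orb (FermionTorus 2 L))) (Finset (Orb (FermionTorus 2 L))) ℂ)
    {lam mstar B C ε : ℝ} (hlam : 0 < lam) (hm : 0 < mstar) (hB : 144 * (2 + |U|) + |μ| ≤ B)
    (hCε : C * ε ≤ mstar ^ 2 / 4)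
    (hSdef : S = -((μ : ℂ) • ((totalNumber : Matrix (Finset (Orb (FermionTorus 2 L)))
            (Finset (Orb (FermionTorus 2 L))) ℂ) - ((2 * n : ℕ) : ℂ) • 1)) +
          ((B ^ 2 / (lam * mstar ^ 2 * (L : ℝ) ^ 2) : ℝ) : ℂ) •
            (((totalNumber : Matrix (Finset (Orb (FermionTorus 2 L)))
              (Finset (Orb (FermionTorus 2 L))) ℂ) - ((2 * n : ℕ) : ℂ) • 1) *
            ((totalNumber : Matrix (Finset (Orb (FermionTorus 2 L)))
              (Finset (Orb (FermionTorus 2 L))) ℂ) - ((2 * n : ℕ) : ℂ) • 1)) -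
          ((lam * mstar ^ 2 / 64 : ℝ) : ℂ) • (pairField dWaveFormFactor L + (pairField dWaveFormFactor L)ᴴ))
    (hWA : ∀ φ : Fock (Orb (FermionTorus 2 L)), star φ ⬝ᵥ φ = 1 →
      (star φ ⬝ᵥ pairField dWaveFormFactor L *ᵥ φ).re ^ 2 / (L : ℝ) ^ 2 ≤ (star φ ⬝ᵥ W *ᵥ φ).re)
    (hGS : ∀ φ : Fock (Orb (FermionTorus 2 L)), star φ ⬝ᵥ φ = 1 →
      (star φ ⬝ᵥ (hubbardTorus 2 L 1 U + (lam : ℂ) • W + S) *ᵥ φ).re =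
        (hubbardTorus 2 L 1 U + (lam : ℂ) • W + S).minEnergyOn ⊤ →
          mstar * (L : ℝ) ^ 2 ≤ (star φ ⬝ᵥ pairField dWaveFormFactor L *ᵥ φ).re) :
    lam * (C * ε + mstar ^ 2 / 4) * (L : ℝ) ^ 2 ≤
      (hubbardTorus 2 L 1 U + (lam : ℂ) • W).minEnergyOn (szSector (2 * n) 0) -
        (hubbardTorus 2 L 1 U).minEnergyOn (szSector (2 * n) 0) := by
  have hLpos : (0 : ℝ) < (L : ℝ) := Nat.cast_pos.2 (Nat.pos_of_ne_zero (NeZero.ne L))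
  have hL2 : (0 : ℝ) < (L : ℝ) ^ 2 := by positivity
  have hB₀ : 0 < 144 * (2 + |U|) + |μ| := by positivity
  have hBpos : 0 < B := lt_of_lt_of_le hB₀ hB
  set k : ℝ := B ^ 2 / (lam * mstar ^ 2 * (L : ℝ) ^ 2) with hkdef
  set h : ℝ := lam * mstar ^ 2 / 64 with hhdef
  have hk : 0 < k := by positivity
  have hh : 0 ≤ h := by positivity
  -- the sector contains a unit vector
  have hnL : n ≤ L ^ 2 := by omega
  obtain ⟨ψ₀, hψ₀, hψ₀gs⟩ :=
    Summit.HubbardSuperconductivity.NoGo.exists_unit_groundStateInSector_hubbardTorus L 1 U hnL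
  -- the bridge
  have hbridge := windowGap_dressedBridge (hubbardTorus 2 L 1 U) W S (pairField dWaveFormFactor L)
    (szSector (2 * n) 0) ⊤ le_top ⟨ψ₀, hψ₀gs.1, hψ₀⟩
    (fun ψ hψK _ => by rw [hSdef]; exact stub_dressingInvisible L (2 * n) μ k h ψ hψK)
    (c := (L : ℝ) ^ 2) (lam := lam) (m := mstar * (L : ℝ) ^ 2) hL2 hlam.le (by positivity)
    (fun φ _ hφ => hWA φ hφ) (fun φ _ hφ hmin => hGS φ hφ hmin)
  -- the charged operator `Y` and the split `H + S = Y − h(Δ + Δᴴ)`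
  set Y : Matrix (Finset (Orb (FermionTorus 2 L))) (Finset (Orb (FermionTorus 2 L))) ℂ :=
    hubbardTorus 2 L 1 U +
      (-((μ : ℂ) • ((totalNumber : Matrix (Finset (Orb (FermionTorus 2 L)))
          (Finset (Orb (FermionTorus 2 L))) ℂ) - ((2 * n : ℕ) : ℂ) • 1)) +
        (k : ℂ) • (((totalNumber : Matrix (Finset (Orb (FermionTorus 2 L)))
          (Finset (Orb (FermionTorus 2 L))) ℂ) - ((2 * n : ℕ) : ℂ) • 1) *
          ((totalNumber : Matrix (Finset (Orb (FermionTorus 2 L)))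
          (Finset (Orb (FermionTorus 2 L))) ℂ) - ((2 * n : ℕ) : ℂ) • 1))) with hYdef
  have hsplit : hubbardTorus 2 L 1 U + S =
      Y - (h : ℂ) • (pairField dWaveFormFactor L + (pairField dWaveFormFactor L)ᴴ) := by
    rw [hSdef, hYdef]
    exact (add_sub_assoc _ _ _).symm
  have hsource := stub_sourceRemoval L Y h hh
  have hcharge := windowGap_chargingFloor L U μ hk hn hn'
  rw [hsplit] at hbridge
  -- windowGap_dressedBookkeeping
  refine windowGap_dressedBookkeeping lam mstar ((L : ℝ) ^ 2) C ε _ B (144 * (2 + |U|) + |μ|) hlam hm hL2 hB₀ hB hCε ?_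
  have e1 : lam * (mstar * (L : ℝ) ^ 2) ^ 2 / (L : ℝ) ^ 2 = lam * mstar ^ 2 * (L : ℝ) ^ 2 := by
    field_simp
  have e2 : (144 * (2 + |U|) + |μ|) ^ 2 / (4 * (B ^ 2 / (lam * mstar ^ 2 * (L : ℝ) ^ 2))) =
      (144 * (2 + |U|) + |μ|) ^ 2 / (4 * k) := by rw [hkdef]
  have e3 : 8 * Real.sqrt 2 * (lam * mstar ^ 2 / 64) * (L : ℝ) ^ 2 = 8 * Real.sqrt 2 * h * (L : ℝ) ^ 2 := by
    rw [hhdef]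
  rw [e1] at hbridge
  rw [e2, e3]
  linarith [hbridge, hsource, hcharge]

/-- Filling windowGap_dressedBookkeeping: for `δ ∈ (0, 1/2)` and `L ≥ 4`, `N_L = 2⌊(1−δ)L²/2⌋` has `N_L ≤ L² ≤ 4N_L`.
[folklore] -/
theorem windowGap_filling_bounds {δ : ℝ} (hδ : δ ∈ Set.Ioo (0 : ℝ) (1 / 2)) {L : ℕ} (hL : 4 ≤ L) :
    2 * ⌊(1 - δ) * (L : ℝ) ^ 2 / 2⌋₊ ≤ L ^ 2 ∧ L ^ 2 ≤ 8 * ⌊(1 - δ) * (L : ℝ) ^ 2 / 2⌋₊ := by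
  obtain ⟨_, _, h8⟩ := JosephsonMirror.filling_floor_bounds hδ hL
  constructor
  · -- `2⌊(1-δ)L²/2⌋ ≤ (1-δ)L² ≤ L²`
    have hx : ((⌊(1 - δ) * (L : ℝ) ^ 2 / 2⌋₊ : ℕ) : ℝ) ≤ (1 - δ) * (L : ℝ) ^ 2 / 2 :=
      Nat.floor_le (by have : (0:ℝ) ≤ 1 - δ := by linarith [hδ.2]
                       positivity)
    have h2 : (2 * ⌊(1 - δ) * (L : ℝ) ^ 2 / 2⌋₊ : ℝ) ≤ (L : ℝ) ^ 2 := by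
      have hL2 : (0 : ℝ) ≤ (L : ℝ) ^ 2 := by positivity
      nlinarith [hδ.1]
    exact_mod_cast h2
  · exact_mod_cast h8

/-- **The crux body at `(U, δ)` from robust quasi-average `d`-wave order of the dressed
grand-canonical torus at `(U, δ, μ)`** — for ANY real `U` (no sign needed; at `U = 0` the hypothesis
is in fact contradictory, `Negative/FreeWindowCalibration.not_windowGapAt_zero`). Given an order floor
`m⋆ > 0`, a charging constant `B ≥ 144(2+|U|) + |μ|`, `ε₁ > 0` and, for every window radius
`ε ∈ (0, ε₁]`, a penalty `λ > 0` such that eventually in even `L` every unit ground state `φ` of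
`H_L + λW_ε − μ(N̂ − N_L) + (B²/(λm⋆²L²))(N̂ − N_L)² − (λm⋆²/64)(Δ_d + Δ_dᴴ)` on the whole Fock space
carries `Re ⟨φ, Δ_d φ⟩ ≥ m⋆L²`, the body of `WindowGap` holds at `(U, δ)`: given `C ≥ 0`, `ε₀ > 0`
take `ε := min ε₁ (min ε₀ (m⋆²/(4C+4)))` (so `Cε ≤ m⋆²/4`), `λ = λ(ε)`, `a := m⋆²/4`, threshold
`max L₀ 4`, and apply `windowGapAt_of_parts` with `stub_windowDominates`. Anderson (1958);
Bogoliubov (1960); Tasaki (2020) §2.1. [folklore] -/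
theorem windowGapAt_of_windowOrderAt {U δ μ mstar B ε₁ : ℝ} (hδ : δ ∈ Set.Ioo (0 : ℝ) (1 / 2))
    (hm : 0 < mstar) (hB : 144 * (2 + |U|) + |μ| ≤ B) (hε₁ : 0 < ε₁)
    (hord : ∀ ε ∈ Set.Ioc (0 : ℝ) ε₁, ∃ lam : ℝ, 0 < lam ∧ ∃ L₀ : ℕ, ∀ (L : ℕ) [NeZero L], L₀ ≤ L → Even L →
        ∀ φ : Fock (Orb (FermionTorus 2 L)), star φ ⬝ᵥ φ = 1 →
          (star φ ⬝ᵥ (hubbardTorus 2 L 1 U + (lam : ℂ) • (∑ m : Fin 2 → ZMod L,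
              if (2 * Real.pi / (L : ℝ)) ^ 2 * (∑ i : Fin 2, (((m i).valMinAbs : ℤ) : ℝ) ^ 2) ≤ ε ^ 2
              then ((L : ℂ) ^ 2)⁻¹ • (Matrix.conjTranspose (pairFieldAt dWaveFormFactor L m) *
                pairFieldAt dWaveFormFactor L m)
              else 0) +
            (-((μ : ℂ) • ((totalNumber : Matrix (Finset (Orb (FermionTorus 2 L)))
                (Finset (Orb (FermionTorus 2 L))) ℂ) - ((2 * ⌊(1 - δ) * (L : ℝ) ^ 2 / 2⌋₊ : ℕ) : ℂ) • 1)) +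
              ((B ^ 2 / (lam * mstar ^ 2 * (L : ℝ) ^ 2) : ℝ) : ℂ) •
                (((totalNumber : Matrix (Finset (Orb (FermionTorus 2 L)))
                  (Finset (Orb (FermionTorus 2 L))) ℂ) - ((2 * ⌊(1 - δ) * (L : ℝ) ^ 2 / 2⌋₊ : ℕ) : ℂ) • 1) *
                ((totalNumber : Matrix (Finset (Orb (FermionTorus 2 L)))
                  (Finset (Orb (FermionTorus 2 L))) ℂ) - ((2 * ⌊(1 - δ) * (L : ℝ) ^ 2 / 2⌋₊ : ℕ) : ℂ) • 1)) -
              ((lam * mstar ^ 2 / 64 : ℝ) : ℂ) •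
                (pairField dWaveFormFactor L + (pairField dWaveFormFactor L)ᴴ))) *ᵥ φ).re =
            (hubbardTorus 2 L 1 U + (lam : ℂ) • (∑ m : Fin 2 → ZMod L,
              if (2 * Real.pi / (L : ℝ)) ^ 2 * (∑ i : Fin 2, (((m i).valMinAbs : ℤ) : ℝ) ^ 2) ≤ ε ^ 2
              then ((L : ℂ) ^ 2)⁻¹ • (Matrix.conjTranspose (pairFieldAt dWaveFormFactor L m) *
                pairFieldAt dWaveFormFactor L m)
              else 0) +
            (-((μ : ℂ) • ((totalNumber : Matrix (Finset (Orb (FermionTorus 2 L)))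
                (Finset (Orb (FermionTorus 2 L))) ℂ) - ((2 * ⌊(1 - δ) * (L : ℝ) ^ 2 / 2⌋₊ : ℕ) : ℂ) • 1)) +
              ((B ^ 2 / (lam * mstar ^ 2 * (L : ℝ) ^ 2) : ℝ) : ℂ) •
                (((totalNumber : Matrix (Finset (Orb (FermionTorus 2 L)))
                  (Finset (Orb (FermionTorus 2 L))) ℂ) - ((2 * ⌊(1 - δ) * (L : ℝ) ^ 2 / 2⌋₊ : ℕ) : ℂ) • 1) *
                ((totalNumber : Matrix (Finset (Orb (FermionTorus 2 L)))
                  (Finset (Orb (FermionTorus 2 L))) ℂ) - ((2 * ⌊(1 - δ) * (L : ℝ) ^ 2 / 2⌋₊ : ℕ) : ℂ) • 1)) -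
              ((lam * mstar ^ 2 / 64 : ℝ) : ℂ) •
                (pairField dWaveFormFactor L + (pairField dWaveFormFactor L)ᴴ))).minEnergyOn ⊤ →
          mstar * (L : ℝ) ^ 2 ≤ (star φ ⬝ᵥ pairField dWaveFormFactor L *ᵥ φ).re) :
    ∀ C : ℝ, 0 ≤ C → ∀ ε₀ : ℝ, 0 < ε₀ → ∃ ε ∈ Set.Ioc (0 : ℝ) ε₀, ∃ lam a : ℝ, 0 < lam ∧ 0 < a ∧
      ∃ L₀ : ℕ, ∀ (L : ℕ) [NeZero L], L₀ ≤ L → Even L →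
        lam * (C * ε + a) * (L : ℝ) ^ 2 ≤
          (hubbardTorus 2 L 1 U + (lam : ℂ) • (∑ m : Fin 2 → ZMod L,
              if (2 * Real.pi / (L : ℝ)) ^ 2 * (∑ i : Fin 2, (((m i).valMinAbs : ℤ) : ℝ) ^ 2) ≤ ε ^ 2
              then ((L : ℂ) ^ 2)⁻¹ • (Matrix.conjTranspose (pairFieldAt dWaveFormFactor L m) *
                pairFieldAt dWaveFormFactor L m)
              else 0)).minEnergyOn (szSector (2 * ⌊(1 - δ) * (L : ℝ) ^ 2 / 2⌋₊) 0) -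
            (hubbardTorus 2 L 1 U).minEnergyOn (szSector (2 * ⌊(1 - δ) * (L : ℝ) ^ 2 / 2⌋₊) 0) := by
  intro C hC ε₀ hε₀
  have hden : (0 : ℝ) < 4 * C + 4 := by linarith
  have hq : 0 < mstar ^ 2 / (4 * C + 4) := div_pos (by positivity) hden
  set ε : ℝ := min ε₁ (min ε₀ (mstar ^ 2 / (4 * C + 4))) with hεdef
  have hεpos : 0 < ε := lt_min hε₁ (lt_min hε₀ hq)
  have hεε₁ : ε ≤ ε₁ := min_le_left _ _
  have hεε₀ : ε ≤ ε₀ := (min_le_right _ _).trans (min_le_left _ _)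
  have hεq : ε ≤ mstar ^ 2 / (4 * C + 4) := (min_le_right _ _).trans (min_le_right _ _)
  have hCε : C * ε ≤ mstar ^ 2 / 4 := by
    have h1 : C * ε ≤ C * (mstar ^ 2 / (4 * C + 4)) := mul_le_mul_of_nonneg_left hεq hC
    have h2 : C * (mstar ^ 2 / (4 * C + 4)) ≤ mstar ^ 2 / 4 := by
      rw [mul_div_assoc', div_le_div_iff₀ hden (by norm_num : (0:ℝ) < 4)]
      nlinarith [sq_nonneg mstar]
    linarith
  obtain ⟨lam, hlam, L₀, hL⟩ := hord ε ⟨hεpos, hεε₁⟩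
  refine ⟨ε, ⟨hεpos, hεε₀⟩, lam, mstar ^ 2 / 4, hlam, by positivity, max L₀ 4, ?_⟩
  intro L _ hL₀ hE
  have hL4 : 4 ≤ L := le_of_max_le_right hL₀
  obtain ⟨hn, hn'⟩ := windowGap_filling_bounds hδ hL4
  exact windowGapAt_of_parts L U μ hn hn' _ _ hlam hm hB hCε rfl
    (fun φ hφ => stub_windowDominates L ε φ hφ)
    (fun φ hφ hmin => hL L (le_of_max_le_left hL₀) hE φ hφ hmin)

/-- **`WindowGap` from robust quasi-average `d`-wave order of the dressed grand-canonical torus**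
(the reduction of line `sector-invisible-dressing`; the hypothesis is the line's registered physics
stub `stub_windowOrder` verbatim): some `U > 0`, `δ ∈ (0,1/2)`, `μ`, `m⋆ > 0`, `B ≥ 144(2+|U|)+|μ|`,
`ε₁ > 0` with the order floor of `windowGapAt_of_windowOrderAt` give `WindowGap`. Anderson (1958);
Bogoliubov (1960). [folklore] -/
theorem windowGap_of_windowOrder
    (hord : ∃ U : ℝ, 0 < U ∧ ∃ δ ∈ Set.Ioo (0 : ℝ) (1 / 2), ∃ μ mstar B ε₁ : ℝ,
      0 < mstar ∧ 144 * (2 + |U|) + |μ| ≤ B ∧ 0 < ε₁ ∧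
      ∀ ε ∈ Set.Ioc (0 : ℝ) ε₁, ∃ lam : ℝ, 0 < lam ∧ ∃ L₀ : ℕ, ∀ (L : ℕ) [NeZero L], L₀ ≤ L → Even L →
        ∀ φ : Fock (Orb (FermionTorus 2 L)), star φ ⬝ᵥ φ = 1 →
          (star φ ⬝ᵥ (hubbardTorus 2 L 1 U + (lam : ℂ) • (∑ m : Fin 2 → ZMod L,
              if (2 * Real.pi / (L : ℝ)) ^ 2 * (∑ i : Fin 2, (((m i).valMinAbs : ℤ) : ℝ) ^ 2) ≤ ε ^ 2
              then ((L : ℂ) ^ 2)⁻¹ • (Matrix.conjTranspose (pairFieldAt dWaveFormFactor L m) *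
                pairFieldAt dWaveFormFactor L m)
              else 0) +
            (-((μ : ℂ) • ((totalNumber : Matrix (Finset (Orb (FermionTorus 2 L)))
                (Finset (Orb (FermionTorus 2 L))) ℂ) - ((2 * ⌊(1 - δ) * (L : ℝ) ^ 2 / 2⌋₊ : ℕ) : ℂ) • 1)) +
              ((B ^ 2 / (lam * mstar ^ 2 * (L : ℝ) ^ 2) : ℝ) : ℂ) •
                (((totalNumber : Matrix (Finset (Orb (FermionTorus 2 L)))
                  (Finset (Orb (FermionTorus 2 L))) ℂ) - ((2 * ⌊(1 - δ) * (L : ℝ) ^ 2 / 2⌋₊ : ℕ) : ℂ) • 1) *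
                ((totalNumber : Matrix (Finset (Orb (FermionTorus 2 L)))
                  (Finset (Orb (FermionTorus 2 L))) ℂ) - ((2 * ⌊(1 - δ) * (L : ℝ) ^ 2 / 2⌋₊ : ℕ) : ℂ) • 1)) -
              ((lam * mstar ^ 2 / 64 : ℝ) : ℂ) •
                (pairField dWaveFormFactor L + (pairField dWaveFormFactor L)ᴴ))) *ᵥ φ).re =
            (hubbardTorus 2 L 1 U + (lam : ℂ) • (∑ m : Fin 2 → ZMod L,
              if (2 * Real.pi / (L : ℝ)) ^ 2 * (∑ i : Fin 2, (((m i).valMinAbs : ℤ) : ℝ) ^ 2) ≤ ε ^ 2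
              then ((L : ℂ) ^ 2)⁻¹ • (Matrix.conjTranspose (pairFieldAt dWaveFormFactor L m) *
                pairFieldAt dWaveFormFactor L m)
              else 0) +
            (-((μ : ℂ) • ((totalNumber : Matrix (Finset (Orb (FermionTorus 2 L)))
                (Finset (Orb (FermionTorus 2 L))) ℂ) - ((2 * ⌊(1 - δ) * (L : ℝ) ^ 2 / 2⌋₊ : ℕ) : ℂ) • 1)) +
              ((B ^ 2 / (lam * mstar ^ 2 * (L : ℝ) ^ 2) : ℝ) : ℂ) •
                (((totalNumber : Matrix (Finset (Orb (FermionTorus 2 L)))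
                  (Finset (Orb (FermionTorus 2 L))) ℂ) - ((2 * ⌊(1 - δ) * (L : ℝ) ^ 2 / 2⌋₊ : ℕ) : ℂ) • 1) *
                ((totalNumber : Matrix (Finset (Orb (FermionTorus 2 L)))
                  (Finset (Orb (FermionTorus 2 L))) ℂ) - ((2 * ⌊(1 - δ) * (L : ℝ) ^ 2 / 2⌋₊ : ℕ) : ℂ) • 1)) -
              ((lam * mstar ^ 2 / 64 : ℝ) : ℂ) •
                (pairField dWaveFormFactor L + (pairField dWaveFormFactor L)ᴴ))).minEnergyOn ⊤ →
          mstar * (L : ℝ) ^ 2 ≤ (star φ ⬝ᵥ pairField dWaveFormFactor L *ᵥ φ).re) :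
    WindowGap := by
  obtain ⟨U, hU, δ, hδ, μ, mstar, B, ε₁, hm, hB, hε₁, hord⟩ := hord
  exact ⟨U, hU, δ, hδ, windowGapAt_of_windowOrderAt hδ hm hB hε₁ hord⟩

end Summit.HubbardSuperconductivity.HubbardSuperconductivity.Theorems
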